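import Summits.NavierStokesRegularity.NavierStokesRegularity.Theorems.PerpetualPumpAveragedTypeIBlowupDieGlobalTools

/-!
# Crux `PerpetualPump.AveragedTypeIBlowup` (stmt-NavierStokesRegularity-1835), line `Sketch`:
# the stub `dieGlobal` — the critical bootstrap after a time of critical smallness

T. Tao, *Finite time blowup for an averaged three-dimensional Navier–Stokes equation*, J. Amer.
Math. Soc. **29** (2016), 601–674 = arXiv:1402.0290v3, §4 p. 22 (4.14) and §5.2: the wavelet
coefficients of a mild solution of the cascade equation solve the exact Volterra chain
`Y_{i,n}(t) = A 1_{(i,n)=(i₀,n₀)} k_{i,n}(t) + ∫₀ᵗ k_{i,n}(t-s) quadTerm(Y)_{i,n}(s) ds` against the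
dissipating heat kernels of the modes, `0 ≤ k_{i,n}(τ) ≤ e^{-4π²(1+ε₀)^{2n}τ}`.

Helper file (theorems only) for the registered stub `stub_dieGlobal` of the lead's skeleton
`Cruxes/AveragedTypeIBlowup/Lines/Sketch.lean`. In the scale-critical units
`z_{i,n} = (1+ε₀)^{n/2}|Y_{i,n}|` the drive of scale `n` has size `K Z² (1+ε₀)^{3n/2}` and the kernel
integral gains `(1+ε₀)^{-2n}/(4π²)`, so after a time `t₀` at which the band-Duhamel majorant is
critically `δ`-small the modes obey `z ≤ δ + (K/4π²) Z²` (`critical_step`); a continuous induction in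
time (`critical_bound`, the registered sub-goal `stub_dieGlobalCritical`) then keeps `z ≤ 2δ` on all of
`[t₀,S)` once `2Kδ ≤ π²`. Measuring one factor of each monomial critically and the other in the weight
`(1+ε₀)^{10k}` gives the linear weight-`10` step `(1+ε₀)^{10n}|Y_{i,n}(t)| ≤ (memory) + M/2`
(`weight_ten_step`, `256Kδ ≤ π²`).

Nothing here closes the item (`--supports`); no statement of the route changes.

## References

* T. Tao, J. Amer. Math. Soc. 29 (2016), 601–674, arXiv:1402.0290v3, §4 p. 22 (4.14), §5.2.
  [`Tao2016AveragedNS`]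
-/

noncomputable section

-- the summit namespace `…NavierStokesRegularity.NavierStokesRegularity…` is the tree convention
set_option linter.dupNamespace false

open MeasureTheory Set Filter Topology
open scoped ENNReal
open Literature.Analysis.FluidPDE
open Literature.Analysis.FluidPDE.TaoCascade (quadTerm shiftSet mem_shiftSet_iff)

namespace Summit.NavierStokesRegularity.NavierStokesRegularity.Theorems.PerpetualPumpAveragedTypeIBlowup

variable {ε₀ : ℝ} {m : ℕ}

/-! ### The critical step -/

/-- **The critical step.** Let `Y` solve the chain on `[0,S)` with dissipating kernels, let the
band-Duhamel majorant at `t₀` be critically small, `(1+ε₀)^{n/2} b_{i,n}(t₀) ≤ δ` for all modes, with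
`2Kδ ≤ π²` (`K ≥ Σ|α_{·,·,i,·}|`), and let `t₀ ≤ t < S`. If `(1+ε₀)^{k/2}|Y_{j,k}| ≤ 2δ` for all modes
on `[t₀,t]`, then `(1+ε₀)^{n/2}|Y_{i,n}(t)| ≤ 3δ/2`: the memory contributes `δ`, and the Volterra term
over `[t₀,t]` at most `K(2δ)²(1+ε₀)^{3n/2}/(4π²(1+ε₀)^{2n}) = (Kδ²/π²)(1+ε₀)^{-n/2}`. [cite: Tao2016AveragedNS, §5.2] -/
theorem critical_step (hε₀ : 0 < ε₀) (α : Fin m → Fin m → Fin m → ℤ × ℤ × ℤ → ℝ) {K : ℝ}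
    (hK : ∀ i : Fin m, (∑ i₁ : Fin m, ∑ i₂ : Fin m, ∑ μ ∈ shiftSet, |α i₁ i₂ i μ|) ≤ K)
    (k : Fin m → ℤ → ℝ → ℝ) (hk0 : ∀ i n τ, 0 ≤ τ → 0 ≤ k i n τ)
    (hk1 : ∀ (i : Fin m) (n : ℤ) (τ : ℝ), 0 ≤ τ →
      k i n τ ≤ Real.exp (-(4 * Real.pi ^ 2 * (1 + ε₀) ^ (2 * n) * τ)))
    (hkc : ∀ i n, Continuous (k i n)) {Y : Fin m → ℤ → ℝ → ℝ} {S : ℝ}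
    (hcont : ∀ i n, ContinuousOn (Y i n) (Ico 0 S)) (i₀ : Fin m) (n₀ : ℤ) (A : ℝ)
    (hchain : ∀ (i : Fin m) (n : ℤ), ∀ t ∈ Ico 0 S,
      Y i n t = (if i = i₀ ∧ n = n₀ then A else 0) * k i n t +
        ∫ s in (0 : ℝ)..t, k i n (t - s) * quadTerm ε₀ α Y i n s)
    {δ : ℝ} (hδ0 : 0 ≤ δ) (hKδ : 2 * K * δ ≤ Real.pi ^ 2) {t₀ : ℝ} (ht₀ : 0 ≤ t₀) (ht₀S : t₀ < S)
    (hsmall : ∀ (i : Fin m) (n : ℤ), (1 + ε₀) ^ ((n : ℝ) / 2) *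
      (Real.exp (-(4 * Real.pi ^ 2 * (1 + ε₀) ^ (2 * n) * t₀)) * (if i = i₀ ∧ n = n₀ then |A| else 0) +
        ∫ s in (0 : ℝ)..t₀, |quadTerm ε₀ α Y i n s| *
          Real.exp (-(4 * Real.pi ^ 2 * (1 + ε₀) ^ (2 * n) * (t₀ - s)))) ≤ δ)
    {t : ℝ} (ht : t₀ ≤ t) (htS : t < S)
    (H : ∀ s ∈ Icc t₀ t, ∀ (j : Fin m) (k' : ℤ), (1 + ε₀) ^ ((k' : ℝ) / 2) * |Y j k' s| ≤ 2 * δ)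
    (i : Fin m) (n : ℤ) :
    (1 + ε₀) ^ ((n : ℝ) / 2) * |Y i n t| ≤ 3 / 2 * δ := by
  have hL0 : 0 < 1 + ε₀ := by linarith
  have hKi := hK i
  have hK0 : 0 ≤ K := le_trans (by positivity) hKi
  have hpow2 : (0 : ℝ) < (1 + ε₀) ^ (2 * n) := zpow_pos hL0 _
  -- the hypothesis in the form `|Y| ≤ 2δ (1+ε₀)^{-k/2}`
  have H' : ∀ s ∈ Icc t₀ t, ∀ (j : Fin m) (k' : ℤ), |Y j k' s| ≤ 2 * δ * (1 + ε₀) ^ (-(1 / 2 * (k' : ℝ))) :=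
    fun s hs j k' => by
      have h := (weight_mul_abs_le_iff hL0 _ _ _).1 (H s hs j k')
      rwa [show -((k' : ℝ) / 2) = -(1 / 2 * (k' : ℝ)) by ring] at h
  -- the Volterra term over `[t₀, t]`
  have hV := abs_volterra_le_of_two_weights hε₀ α k hk0 hk1 (w₁ := 1 / 2) (w₂ := 1 / 2)
    (e := 3 / 2 * n) (n := n) (by norm_num) (by norm_num) (by positivity) (by positivity) (by linarith)
    (by linarith) ht H' H' i
  -- the memory
  have hF := abs_memory_le hε₀ α k hk0 hk1 hcont i₀ n₀ A i n ht₀ ht₀S ht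
  have hpow : (1 + ε₀) ^ ((n : ℝ) / 2) * (1 + ε₀) ^ ((3 : ℝ) / 2 * n) = (1 + ε₀) ^ (2 * n) := by
    rw [← Real.rpow_add hL0, ← Real.rpow_intCast]
    congr 1
    push_cast
    ring
  have hq : (1 + ε₀) ^ ((n : ℝ) / 2) *
      ((∑ i₁ : Fin m, ∑ i₂ : Fin m, ∑ μ ∈ shiftSet, |α i₁ i₂ i μ|) * (2 * δ * (2 * δ)) *
        (1 + ε₀) ^ ((3 : ℝ) / 2 * n) / (4 * Real.pi ^ 2 * (1 + ε₀) ^ (2 * n))) ≤ δ / 2 := by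
    rw [show (1 + ε₀) ^ ((n : ℝ) / 2) *
      ((∑ i₁ : Fin m, ∑ i₂ : Fin m, ∑ μ ∈ shiftSet, |α i₁ i₂ i μ|) * (2 * δ * (2 * δ)) *
        (1 + ε₀) ^ ((3 : ℝ) / 2 * n) / (4 * Real.pi ^ 2 * (1 + ε₀) ^ (2 * n))) =
      (∑ i₁ : Fin m, ∑ i₂ : Fin m, ∑ μ ∈ shiftSet, |α i₁ i₂ i μ|) * δ ^ 2 / Real.pi ^ 2 *
        (((1 + ε₀) ^ ((n : ℝ) / 2) * (1 + ε₀) ^ ((3 : ℝ) / 2 * n)) / (1 + ε₀) ^ (2 * n)) by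
      field_simp
      ring, hpow, div_self hpow2.ne', mul_one, div_le_iff₀ (by positivity)]
    calc (∑ i₁ : Fin m, ∑ i₂ : Fin m, ∑ μ ∈ shiftSet, |α i₁ i₂ i μ|) * δ ^ 2 ≤ K * δ ^ 2 :=
          mul_le_mul_of_nonneg_right hKi (by positivity)
      _ ≤ δ / 2 * Real.pi ^ 2 := by nlinarith
  calc (1 + ε₀) ^ ((n : ℝ) / 2) * |Y i n t|
      = (1 + ε₀) ^ ((n : ℝ) / 2) * |((if i = i₀ ∧ n = n₀ then A else 0) * k i n t +
          ∫ s in (0 : ℝ)..t₀, k i n (t - s) * quadTerm ε₀ α Y i n s) +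
          ∫ s in t₀..t, k i n (t - s) * quadTerm ε₀ α Y i n s| := by
        rw [← chain_split α k hkc hcont i₀ n₀ A hchain i n ht₀ ht htS]
    _ ≤ (1 + ε₀) ^ ((n : ℝ) / 2) * |(if i = i₀ ∧ n = n₀ then A else 0) * k i n t +
          ∫ s in (0 : ℝ)..t₀, k i n (t - s) * quadTerm ε₀ α Y i n s| +
        (1 + ε₀) ^ ((n : ℝ) / 2) * |∫ s in t₀..t, k i n (t - s) * quadTerm ε₀ α Y i n s| := by
        rw [← mul_add]
        exact mul_le_mul_of_nonneg_left (abs_add_le _ _) (Real.rpow_nonneg hL0.le _)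
    _ ≤ δ + δ / 2 :=
        add_le_add ((mul_le_mul_of_nonneg_left hF (Real.rpow_nonneg hL0.le _)).trans (hsmall i n))
          ((mul_le_mul_of_nonneg_left hV (Real.rpow_nonneg hL0.le _)).trans hq)
    _ = 3 / 2 * δ := by ring

/-- **The weight-`10` step.** In the situation of `critical_step`, if moreover `ε₀ ≤ 1`,
`256Kδ ≤ π²`, all modes are critically bounded by `2δ` on `[t₀,t]` and
`(1+ε₀)^{10k}|Y_{j,k}| ≤ M` on `[t₀,t]`, then
`(1+ε₀)^{10n}|Y_{i,n}(t)| ≤ (1+ε₀)^{10n}|memory_{i,n}(t)| + M/2`: one factor of each monomial is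
measured critically and the other in the weight `10`, so the Volterra term over `[t₀,t]` is at most
`K(2δ)M(1+ε₀)^{8-8n}/(4π²(1+ε₀)^{2n})`, and `(1+ε₀)^8 ≤ 256`. [cite: Tao2016AveragedNS, §5.2] -/
theorem weight_ten_step (hε₀ : 0 < ε₀) (hε₁ : ε₀ ≤ 1) (α : Fin m → Fin m → Fin m → ℤ × ℤ × ℤ → ℝ)
    {K : ℝ} (hK : ∀ i : Fin m, (∑ i₁ : Fin m, ∑ i₂ : Fin m, ∑ μ ∈ shiftSet, |α i₁ i₂ i μ|) ≤ K)
    (k : Fin m → ℤ → ℝ → ℝ) (hk0 : ∀ i n τ, 0 ≤ τ → 0 ≤ k i n τ)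
    (hk1 : ∀ (i : Fin m) (n : ℤ) (τ : ℝ), 0 ≤ τ →
      k i n τ ≤ Real.exp (-(4 * Real.pi ^ 2 * (1 + ε₀) ^ (2 * n) * τ)))
    (hkc : ∀ i n, Continuous (k i n)) {Y : Fin m → ℤ → ℝ → ℝ} {S : ℝ}
    (hcont : ∀ i n, ContinuousOn (Y i n) (Ico 0 S)) (i₀ : Fin m) (n₀ : ℤ) (A : ℝ)
    (hchain : ∀ (i : Fin m) (n : ℤ), ∀ t ∈ Ico 0 S,
      Y i n t = (if i = i₀ ∧ n = n₀ then A else 0) * k i n t +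
        ∫ s in (0 : ℝ)..t, k i n (t - s) * quadTerm ε₀ α Y i n s)
    {δ : ℝ} (hδ0 : 0 ≤ δ) (hKδ : 256 * K * δ ≤ Real.pi ^ 2) {t₀ : ℝ} (ht₀ : 0 ≤ t₀)
    {t : ℝ} (ht : t₀ ≤ t) (htS : t < S)
    (H : ∀ s ∈ Icc t₀ t, ∀ (j : Fin m) (k' : ℤ), (1 + ε₀) ^ ((k' : ℝ) / 2) * |Y j k' s| ≤ 2 * δ)
    {M : ℝ} (hM0 : 0 ≤ M)
    (HM : ∀ s ∈ Icc t₀ t, ∀ (j : Fin m) (k' : ℤ), (1 + ε₀) ^ ((10 : ℝ) * k') * |Y j k' s| ≤ M)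
    (i : Fin m) (n : ℤ) :
    (1 + ε₀) ^ ((10 : ℝ) * n) * |Y i n t| ≤
      (1 + ε₀) ^ ((10 : ℝ) * n) * |(if i = i₀ ∧ n = n₀ then A else 0) * k i n t +
          ∫ s in (0 : ℝ)..t₀, k i n (t - s) * quadTerm ε₀ α Y i n s| + M / 2 := by
  have hL0 : 0 < 1 + ε₀ := by linarith
  have hL2 : 1 + ε₀ ≤ 2 := by linarith
  have hKi := hK i
  have hK0 : 0 ≤ K := le_trans (by positivity) hKi
  have hpow2 : (0 : ℝ) < (1 + ε₀) ^ (2 * n) := zpow_pos hL0 _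
  have H' : ∀ s ∈ Icc t₀ t, ∀ (j : Fin m) (k' : ℤ), |Y j k' s| ≤ 2 * δ * (1 + ε₀) ^ (-(1 / 2 * (k' : ℝ))) :=
    fun s hs j k' => by
      have h := (weight_mul_abs_le_iff hL0 _ _ _).1 (H s hs j k')
      rwa [show -((k' : ℝ) / 2) = -(1 / 2 * (k' : ℝ)) by ring] at h
  have HM' : ∀ s ∈ Icc t₀ t, ∀ (j : Fin m) (k' : ℤ), |Y j k' s| ≤ M * (1 + ε₀) ^ (-(10 * (k' : ℝ))) :=
    fun s hs j k' => (weight_mul_abs_le_iff hL0 _ _ _).1 (HM s hs j k')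
  have hV := abs_volterra_le_of_two_weights hε₀ α k hk0 hk1 (w₁ := 1 / 2) (w₂ := 10)
    (e := -8 * n + 8) (n := n) (by norm_num) (by norm_num) (by positivity) hM0 (by linarith)
    (by linarith) ht H' HM' i
  have hpow : (1 + ε₀) ^ ((10 : ℝ) * n) * (1 + ε₀) ^ ((-8 : ℝ) * n + 8) =
      (1 + ε₀) ^ (2 * n) * (1 + ε₀) ^ (8 : ℕ) := by
    rw [← Real.rpow_add hL0, ← Real.rpow_intCast, ← Real.rpow_natCast, ← Real.rpow_add hL0]
    congr 1
    push_cast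
    ring
  have h256 : (1 + ε₀) ^ (8 : ℕ) ≤ 256 := by
    calc (1 + ε₀) ^ (8 : ℕ) ≤ (2 : ℝ) ^ (8 : ℕ) := pow_le_pow_left₀ hL0.le hL2 8
      _ = 256 := by norm_num
  have hq : (1 + ε₀) ^ ((10 : ℝ) * n) *
      ((∑ i₁ : Fin m, ∑ i₂ : Fin m, ∑ μ ∈ shiftSet, |α i₁ i₂ i μ|) * (2 * δ * M) *
        (1 + ε₀) ^ ((-8 : ℝ) * n + 8) / (4 * Real.pi ^ 2 * (1 + ε₀) ^ (2 * n))) ≤ M / 2 := by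
    rw [show (1 + ε₀) ^ ((10 : ℝ) * n) *
      ((∑ i₁ : Fin m, ∑ i₂ : Fin m, ∑ μ ∈ shiftSet, |α i₁ i₂ i μ|) * (2 * δ * M) *
        (1 + ε₀) ^ ((-8 : ℝ) * n + 8) / (4 * Real.pi ^ 2 * (1 + ε₀) ^ (2 * n))) =
      (∑ i₁ : Fin m, ∑ i₂ : Fin m, ∑ μ ∈ shiftSet, |α i₁ i₂ i μ|) * (δ * M) / (2 * Real.pi ^ 2) *
        (((1 + ε₀) ^ ((10 : ℝ) * n) * (1 + ε₀) ^ ((-8 : ℝ) * n + 8)) / (1 + ε₀) ^ (2 * n)) by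
      field_simp
      ring, hpow, mul_div_cancel_left₀ _ hpow2.ne', div_mul_eq_mul_div, div_le_iff₀ (by positivity)]
    calc (∑ i₁ : Fin m, ∑ i₂ : Fin m, ∑ μ ∈ shiftSet, |α i₁ i₂ i μ|) * (δ * M) * (1 + ε₀) ^ (8 : ℕ)
        ≤ K * (δ * M) * 256 := mul_le_mul (mul_le_mul_of_nonneg_right hKi (by positivity)) h256
          (by positivity) (by positivity)
      _ ≤ M / 2 * (2 * Real.pi ^ 2) := by nlinarith [mul_le_mul_of_nonneg_right hKδ hM0]
  calc (1 + ε₀) ^ ((10 : ℝ) * n) * |Y i n t|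
      = (1 + ε₀) ^ ((10 : ℝ) * n) * |((if i = i₀ ∧ n = n₀ then A else 0) * k i n t +
          ∫ s in (0 : ℝ)..t₀, k i n (t - s) * quadTerm ε₀ α Y i n s) +
          ∫ s in t₀..t, k i n (t - s) * quadTerm ε₀ α Y i n s| := by
        rw [← chain_split α k hkc hcont i₀ n₀ A hchain i n ht₀ ht htS]
    _ ≤ (1 + ε₀) ^ ((10 : ℝ) * n) * |(if i = i₀ ∧ n = n₀ then A else 0) * k i n t +
          ∫ s in (0 : ℝ)..t₀, k i n (t - s) * quadTerm ε₀ α Y i n s| +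
        (1 + ε₀) ^ ((10 : ℝ) * n) * |∫ s in t₀..t, k i n (t - s) * quadTerm ε₀ α Y i n s| := by
        rw [← mul_add]
        exact mul_le_mul_of_nonneg_left (abs_add_le _ _) (Real.rpow_nonneg hL0.le _)
    _ ≤ _ := by
        gcongr ?_ + ?_
        · exact le_rfl
        · exact (mul_le_mul_of_nonneg_left hV (Real.rpow_nonneg hL0.le _)).trans hq

/-! ### The critical bound on `[t₀, S)` by continuous induction -/

/-- **Critical smallness at `t₀` propagates: the critical bound on `[t₀,S)`.** Let `Y` solve the chain
on `[0,S)` with dissipating kernels (continuous, no modes below `n₀`, `(1+ε₀)^{20n}`-bounded on compact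
sub-intervals), and let `(1+ε₀)^{n/2} b_{i,n}(t₀) ≤ δ` for all modes, `2Kδ ≤ π²`, `δ > 0`. Then
`(1+ε₀)^{n/2}|Y_{i,n}(t)| ≤ 2δ` for all modes and all `t ∈ [t₀,S)`. Continuous induction on `[t₀,b]`
(`b < S`) for the closed set of times where all modes are critically bounded by `2δ`: at `t₀` the bound
is `δ`; if it holds on `[t₀,t]` then `critical_step` improves it to `3δ/2` there, the finitely many modes
`n₀ ≤ k < N` stay below `2δ` a little longer by continuity, the modes `k ≥ N` are below `δ` on all of
`[0,b]` by the `(1+ε₀)^{20k}` bound, and the modes `k < n₀` vanish. [cite: Tao2016AveragedNS, §5.2] -/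
theorem critical_bound (hε₀ : 0 < ε₀) (α : Fin m → Fin m → Fin m → ℤ × ℤ × ℤ → ℝ) {K : ℝ}
    (hK : ∀ i : Fin m, (∑ i₁ : Fin m, ∑ i₂ : Fin m, ∑ μ ∈ shiftSet, |α i₁ i₂ i μ|) ≤ K)
    (k : Fin m → ℤ → ℝ → ℝ) (hk0 : ∀ i n τ, 0 ≤ τ → 0 ≤ k i n τ)
    (hk1 : ∀ (i : Fin m) (n : ℤ) (τ : ℝ), 0 ≤ τ →
      k i n τ ≤ Real.exp (-(4 * Real.pi ^ 2 * (1 + ε₀) ^ (2 * n) * τ)))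
    (hkc : ∀ i n, Continuous (k i n)) (i₀ : Fin m) (n₀ : ℤ) (A S : ℝ) (Y : Fin m → ℤ → ℝ → ℝ)
    (hcont : ∀ i n, ContinuousOn (Y i n) (Ico 0 S)) (hlow : ∀ i n t, n < n₀ → Y i n t = 0)
    (hdec : ∀ S' : ℝ, S' < S → ∃ C : ℝ, ∀ (i : Fin m) (n : ℤ), ∀ t ∈ Icc 0 S',
      (1 + ε₀) ^ ((20 : ℝ) * n) * |Y i n t| ≤ C)
    (hchain : ∀ (i : Fin m) (n : ℤ), ∀ t ∈ Ico 0 S,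
      Y i n t = (if i = i₀ ∧ n = n₀ then A else 0) * k i n t +
        ∫ s in (0 : ℝ)..t, k i n (t - s) * quadTerm ε₀ α Y i n s)
    {δ : ℝ} (hδ0 : 0 < δ) (hKδ : 2 * K * δ ≤ Real.pi ^ 2) {t₀ : ℝ} (ht₀ : t₀ ∈ Ico 0 S)
    (hsmall : ∀ (i : Fin m) (n : ℤ), (1 + ε₀) ^ ((n : ℝ) / 2) *
      (Real.exp (-(4 * Real.pi ^ 2 * (1 + ε₀) ^ (2 * n) * t₀)) * (if i = i₀ ∧ n = n₀ then |A| else 0) +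
        ∫ s in (0 : ℝ)..t₀, |quadTerm ε₀ α Y i n s| *
          Real.exp (-(4 * Real.pi ^ 2 * (1 + ε₀) ^ (2 * n) * (t₀ - s)))) ≤ δ) :
    ∀ t ∈ Ico t₀ S, ∀ (i : Fin m) (n : ℤ), (1 + ε₀) ^ ((n : ℝ) / 2) * |Y i n t| ≤ 2 * δ := by
  intro b hb
  have hL0 : 0 < 1 + ε₀ := by linarith
  have hL1 : 1 < 1 + ε₀ := by linarith
  have hbS : b < S := hb.2
  have hIcc : Icc t₀ b ⊆ Ico 0 S := fun t ht => ⟨ht₀.1.trans ht.1, ht.2.trans_lt hbS⟩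
  set s : Set ℝ := {t | ∀ (i : Fin m) (n : ℤ), (1 + ε₀) ^ ((n : ℝ) / 2) * |Y i n t| ≤ 2 * δ}
    with hs_def
  suffices h : Icc t₀ b ⊆ s from fun i n => h ⟨hb.1, le_rfl⟩ i n
  have hgc : ∀ (i : Fin m) (n : ℤ),
      ContinuousOn (fun t => (1 + ε₀) ^ ((n : ℝ) / 2) * |Y i n t|) (Icc t₀ b) := fun i n =>
    continuousOn_const.mul (continuous_abs.comp_continuousOn ((hcont i n).mono hIcc))
  refine IsClosed.Icc_subset_of_forall_mem_nhdsGT_of_Icc_subset ?_ ?_ ?_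
  · -- the set is closed in `[t₀, b]`
    have hset : s ∩ Icc t₀ b = (⋂ i : Fin m, ⋂ n : ℤ, Icc t₀ b ∩
        (fun t => (1 + ε₀) ^ ((n : ℝ) / 2) * |Y i n t|) ⁻¹' Iic (2 * δ)) ∩ Icc t₀ b := by
      ext t
      simp only [hs_def, mem_inter_iff, mem_setOf_eq, mem_iInter, mem_preimage, mem_Iic]
      exact ⟨fun h => ⟨fun i n => ⟨h.2, h.1 i n⟩, h.2⟩, fun h => ⟨fun i n => (h.1 i n).2, h.2⟩⟩
    rw [hset]
    exact (isClosed_iInter fun i => isClosed_iInter fun n =>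
      (hgc i n).preimage_isClosed_of_isClosed isClosed_Icc isClosed_Iic).inter isClosed_Icc
  · -- at `t₀`
    intro i n
    show (1 + ε₀) ^ ((n : ℝ) / 2) * |Y i n t₀| ≤ 2 * δ
    rw [hchain i n t₀ ht₀]
    calc (1 + ε₀) ^ ((n : ℝ) / 2) * |(if i = i₀ ∧ n = n₀ then A else 0) * k i n t₀ +
          ∫ s in (0 : ℝ)..t₀, k i n (t₀ - s) * quadTerm ε₀ α Y i n s|
        ≤ (1 + ε₀) ^ ((n : ℝ) / 2) *
          (Real.exp (-(4 * Real.pi ^ 2 * (1 + ε₀) ^ (2 * n) * t₀)) * (if i = i₀ ∧ n = n₀ then |A| else 0) +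
            ∫ s in (0 : ℝ)..t₀, |quadTerm ε₀ α Y i n s| *
              Real.exp (-(4 * Real.pi ^ 2 * (1 + ε₀) ^ (2 * n) * (t₀ - s)))) :=
          mul_le_mul_of_nonneg_left (abs_memory_le hε₀ α k hk0 hk1 hcont i₀ n₀ A i n ht₀.1 ht₀.2
            le_rfl) (Real.rpow_nonneg hL0.le _)
      _ ≤ δ := hsmall i n
      _ ≤ 2 * δ := by linarith
  · -- propagation to the right of `t`
    intro t ht hts
    have htS : t < S := ht.2.trans hbS
    have ht0 : 0 ≤ t := ht₀.1.trans ht.1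
    -- the improved bound on `[t₀, t]`
    have himp : ∀ s' ∈ Icc t₀ t, ∀ (i : Fin m) (n : ℤ),
        (1 + ε₀) ^ ((n : ℝ) / 2) * |Y i n s'| ≤ 3 / 2 * δ := fun s' hs' i n =>
      critical_step hε₀ α hK k hk0 hk1 hkc hcont i₀ n₀ A hchain hδ0.le hKδ ht₀.1 ht₀.2 hsmall hs'.1
        (hs'.2.trans_lt htS) (fun s'' hs'' j k' => hts ⟨hs''.1, hs''.2.trans hs'.2⟩ j k') i n
    -- the tail of high modes on `[0, b]`
    obtain ⟨Cb, hCb⟩ := hdec b hbS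
    obtain ⟨N, hN⟩ : ∃ N : ℤ, ∀ (j : Fin m) (k' : ℤ), N ≤ k' → ∀ s' ∈ Icc 0 b,
        (1 + ε₀) ^ ((k' : ℝ) / 2) * |Y j k' s'| ≤ δ := by
      have hCb0 : 0 ≤ Cb :=
        le_trans (mul_nonneg (Real.rpow_nonneg hL0.le _) (abs_nonneg _))
          (hCb i₀ n₀ 0 ⟨le_rfl, ht₀.1.trans hb.1⟩)
      set r : ℝ := (1 + ε₀) ^ (-(39 / 2 : ℝ)) with hr
      have hr0 : 0 < r := Real.rpow_pos_of_pos hL0 _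
      have hr1 : r < 1 := Real.rpow_lt_one_of_one_lt_of_neg hL1 (by norm_num)
      obtain ⟨N₀, hN₀⟩ := exists_pow_lt_of_lt_one (div_pos hδ0 (by linarith : (0 : ℝ) < Cb + 1)) hr1
      refine ⟨N₀, fun j k' hk' s' hs' => ?_⟩
      have hsplit : (1 + ε₀) ^ ((k' : ℝ) / 2) = r ^ (k' : ℝ) * (1 + ε₀) ^ ((20 : ℝ) * k') := by
        rw [hr, ← Real.rpow_mul hL0.le, ← Real.rpow_add hL0]
        congr 1
        ring
      have hrk : r ^ (k' : ℝ) ≤ r ^ N₀ := by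
        rw [← Real.rpow_natCast]
        exact Real.rpow_le_rpow_of_exponent_ge hr0 hr1.le (by exact_mod_cast hk')
      rw [hsplit, mul_assoc]
      calc r ^ (k' : ℝ) * ((1 + ε₀) ^ ((20 : ℝ) * k') * |Y j k' s'|) ≤ r ^ N₀ * Cb :=
            mul_le_mul hrk (hCb j k' s' hs') (mul_nonneg (Real.rpow_nonneg hL0.le _) (abs_nonneg _))
              (pow_nonneg hr0.le _)
        _ ≤ δ / (Cb + 1) * Cb := mul_le_mul_of_nonneg_right hN₀.le hCb0
        _ ≤ δ := by
            rw [div_mul_eq_mul_div, div_le_iff₀ (by linarith)]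
            nlinarith
    -- the finitely many middle modes, by continuity at `t`
    have hfin : ∀ᶠ s' in 𝓝[>] t, ∀ p ∈ (Finset.univ : Finset (Fin m)) ×ˢ Finset.Ico n₀ N,
        (1 + ε₀) ^ ((p.2 : ℝ) / 2) * |Y p.1 p.2 s'| < 2 * δ := by
      refine (Filter.eventually_all_finset _).2 fun p _ => ?_
      have hc : ContinuousWithinAt (fun s' => (1 + ε₀) ^ ((p.2 : ℝ) / 2) * |Y p.1 p.2 s'|)
          (Ico 0 S) t :=
        (continuousOn_const.mul (continuous_abs.comp_continuousOn (hcont p.1 p.2))) t ⟨ht0, htS⟩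
      have hlt : (1 + ε₀) ^ ((p.2 : ℝ) / 2) * |Y p.1 p.2 t| < 2 * δ :=
        (himp t ⟨ht.1, le_rfl⟩ p.1 p.2).trans_lt (by linarith)
      have hle : 𝓝[>] t ≤ 𝓝[Ico 0 S] t :=
        nhdsWithin_le_of_mem (mem_of_superset (Ioo_mem_nhdsGT htS)
          fun x hx => ⟨ht0.trans hx.1.le, hx.2⟩)
      exact (hc.tendsto.eventually_lt_const hlt).filter_mono hle
    have hnear : ∀ᶠ s' in 𝓝[>] t, s' ∈ Ioo t b := Ioo_mem_nhdsGT ht.2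
    filter_upwards [hfin, hnear] with s' h1 h2
    intro j k'
    show (1 + ε₀) ^ ((k' : ℝ) / 2) * |Y j k' s'| ≤ 2 * δ
    rcases lt_or_ge k' n₀ with hk' | hk'
    · rw [hlow j k' s' hk', abs_zero, mul_zero]
      positivity
    rcases le_or_gt N k' with hNk | hNk
    · exact (hN j k' hNk s' ⟨ht0.trans h2.1.le, h2.2.le⟩).trans (by linarith)
    · exact (h1 (j, k') (Finset.mem_product.2 ⟨Finset.mem_univ _, Finset.mem_Ico.2 ⟨hk', hNk⟩⟩)).le

/-! ### The registered sub-goal -/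

/-- **Registered sub-goal `stub_dieGlobalCritical` of the stub `dieGlobal`** (`critical_bound`, closed
form): for a continuous solution of the Volterra chain on `[0,S)` against dissipating kernels
`0 ≤ k_{i,n}(τ) ≤ e^{-4π²(1+ε₀)^{2n}τ}` (no modes below `n₀`, `(1+ε₀)^{20n}`-bounded on compact
sub-intervals), critical `δ`-smallness of the band-Duhamel majorant at `t₀` with `2Kδ ≤ π²`
(`K ≥ Σ|α_{·,·,i,·}|`) gives `(1+ε₀)^{n/2}|Y_{i,n}(t)| ≤ 2δ` for all modes and all `t ∈ [t₀,S)`. [cite: Tao2016AveragedNS, §5.2] -/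
theorem stub_dieGlobalCritical :
    ∀ {ε₀ : ℝ}, 0 < ε₀ → ∀ {m : ℕ} (α : Fin m → Fin m → Fin m → ℤ × ℤ × ℤ → ℝ) (K : ℝ),
      (∀ i : Fin m, (∑ i₁ : Fin m, ∑ i₂ : Fin m, ∑ μ ∈ TaoCascade.shiftSet, |α i₁ i₂ i μ|) ≤ K) →
      ∀ (k : Fin m → ℤ → ℝ → ℝ), (∀ i n τ, 0 ≤ τ → 0 ≤ k i n τ) →
      (∀ (i : Fin m) (n : ℤ) (τ : ℝ), 0 ≤ τ →
        k i n τ ≤ Real.exp (-(4 * Real.pi ^ 2 * (1 + ε₀) ^ (2 * n) * τ))) →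
      (∀ i n, Continuous (k i n)) →
      ∀ (i₀ : Fin m) (n₀ : ℤ) (A S : ℝ) (Y : Fin m → ℤ → ℝ → ℝ),
      (∀ i n, ContinuousOn (Y i n) (Ico 0 S)) → (∀ i n t, n < n₀ → Y i n t = 0) →
      (∀ S' : ℝ, S' < S → ∃ C : ℝ, ∀ (i : Fin m) (n : ℤ), ∀ t ∈ Icc 0 S',
        (1 + ε₀) ^ ((20 : ℝ) * n) * |Y i n t| ≤ C) →
      (∀ (i : Fin m) (n : ℤ), ∀ t ∈ Ico 0 S,
        Y i n t = (if i = i₀ ∧ n = n₀ then A else 0) * k i n t +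
          ∫ s in (0 : ℝ)..t, k i n (t - s) * quadTerm ε₀ α Y i n s) →
      ∀ (δ : ℝ), 0 < δ → 2 * K * δ ≤ Real.pi ^ 2 → ∀ (t₀ : ℝ), t₀ ∈ Ico 0 S →
      (∀ (i : Fin m) (n : ℤ), (1 + ε₀) ^ ((n : ℝ) / 2) *
        (Real.exp (-(4 * Real.pi ^ 2 * (1 + ε₀) ^ (2 * n) * t₀)) * (if i = i₀ ∧ n = n₀ then |A| else 0) +
          ∫ s in (0 : ℝ)..t₀, |quadTerm ε₀ α Y i n s| *
            Real.exp (-(4 * Real.pi ^ 2 * (1 + ε₀) ^ (2 * n) * (t₀ - s)))) ≤ δ) →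
      ∀ t ∈ Ico t₀ S, ∀ (i : Fin m) (n : ℤ), (1 + ε₀) ^ ((n : ℝ) / 2) * |Y i n t| ≤ 2 * δ :=
  fun hε₀ _ α _ hK k hk0 hk1 hkc i₀ n₀ A S Y hcont hlow hdec hchain _ hδ0 hKδ _ ht₀ hsmall =>
    critical_bound hε₀ α hK k hk0 hk1 hkc i₀ n₀ A S Y hcont hlow hdec hchain hδ0 hKδ ht₀ hsmall

end Summit.NavierStokesRegularity.NavierStokesRegularity.Theorems.PerpetualPumpAveragedTypeIBlowup

end
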